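import Mathlib
import Literature.AlgebraicGeometry.Resolution.WeightedCentreGradedIsotropy

/-!
# A graded endomorphism of `k[ε][σ]` congruent to the identity modulo `σ` is an automorphism (engine 1's `W(f)` toy model, target T101 — an instrument, NOT a resolution theorem)

RE-DERIVATION-eng1-g43 §3.1 works in the GROUP `𝔄` of graded `k[σ]`-automorphisms of `S = k[σ][ε]` fixing `σ` and
`≡ id (mod σ)`; the cell's isotropies are so far only ring ENDOMORPHISMS `Φ : k[ε][σ] →+* k[ε][σ]` (`IsGradedHom`,
`IsIsotropyOf`).  This file supplies the missing inverse, so that the order filtration / eigen-coset lifting instruments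
(`WeightedCentreOrderFiltration`, `WeightedCentreEigenCosetLift`, stated for `S ≃+* S`) apply to them:

* `X_pow_dvd_map_sub` — congruences are checked on generators: if `Φ σ = σ`, `Φ` fixes the scalars and
  `σ^m ∣ Φ ε_i - ε_i` for every slot `i`, then `σ^m ∣ Φ y - y` for EVERY `y` ((F1)'s "`A ≡ id mod σ^m`");
* `injective` — such a `Φ` (with `m = 1`) is injective (look at the lowest `σ`-order term; no grading needed);
* `surjective` — if moreover `Φ` is GRADED for positive weights (`0 ≤ w i`, `0 < ρ = wt σ`), it is surjective: on the
  generator `ε_i` (total weight `w i`) the operator `N = id - Φ` raises the `σ`-order and preserves the total weight, so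
  `N^n ε_i = 0` as soon as `n ρ > w i` (`isTW_eq_zero_of_X_pow_dvd`), and the finite Neumann series `Σ_{k<n} N^k ε_i` is a
  preimage (`mul_neg_geom_sum` in the ring `AddMonoid.End S`);
* `toRingEquiv` — the resulting `S ≃+* S`, with `toRingEquiv_apply` and the congruence of the inverse `X_pow_dvd_symm_apply_sub`.

Framing: instrument for engine 1's `W(f)` toy model (cell `pub-rosobs`, carver lane gen 63; AI-written Lean, AI review weaker than
expert review), NOT a statement about the invariant of [AbramovichTemkinWlodarczyk2024], NOT a resolution theorem.  The algebra is
the elementary "unipotent ⇒ invertible via the geometric series" [Lang2002, Ch. IV §1, Ch. XIII §4]; formalisation ours.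
-/

namespace Literature.AlgebraicGeometry.Resolution.WeightedBlowup.UnipotentInverse

open Polynomial

variable {k : Type*} [CommRing k] {ι : Type*}

/-- **Congruences are checked on generators.**  If `Φ σ = σ`, `Φ` fixes the scalars and `σ^m ∣ Φ ε_i - ε_i` for all slots `i`,
then `σ^m ∣ Φ y - y` for every `y ∈ k[ε][σ]` ((F1) of RE-DERIVATION-eng1-g43 §3.1; bookkeeping). [cite: Lang2002, Ch. IV §1] -/
theorem X_pow_dvd_map_sub {Φ : (MvPolynomial ι k)[X] →+* (MvPolynomial ι k)[X]} (m : ℕ) (hX : Φ X = X)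
    (hC : ∀ c : k, Φ (C (MvPolynomial.C c)) = C (MvPolynomial.C c))
    (hgen : ∀ i, X ^ m ∣ Φ (C (MvPolynomial.X i)) - C (MvPolynomial.X i)) (y : (MvPolynomial ι k)[X]) :
    X ^ m ∣ Φ y - y := by
  have hCa : ∀ a : MvPolynomial ι k, X ^ m ∣ Φ (C a) - C a := by
    intro a
    induction a using MvPolynomial.induction_on with
    | C c => simp [hC c]
    | add p q hp hq => simpa [map_add, add_sub_add_comm] using dvd_add hp hq
    | mul_X p i hp =>
      have e : Φ (C (p * MvPolynomial.X i)) - C (p * MvPolynomial.X i) =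
          (Φ (C p) - C p) * Φ (C (MvPolynomial.X i)) + C p * (Φ (C (MvPolynomial.X i)) - C (MvPolynomial.X i)) := by
        rw [map_mul, map_mul]; ring
      rw [e]
      exact dvd_add (hp.mul_right _) ((hgen i).mul_left _)
  induction y using Polynomial.induction_on' with
  | add p q hp hq => simpa [map_add, add_sub_add_comm] using dvd_add hp hq
  | monomial n a =>
    rw [← C_mul_X_pow_eq_monomial, map_mul, map_pow, hX, ← sub_mul]
    exact (hCa a).mul_right _

/-- A ring endomorphism of `k[ε][σ]` fixing `σ` and the scalars and `≡ id (mod σ)` on the slots is INJECTIVE: the lowest `σ`-order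
coefficient of `y ≠ 0` survives in `Φ y` (bookkeeping; no grading needed). [cite: Lang2002, Ch. IV §1] -/
theorem injective {Φ : (MvPolynomial ι k)[X] →+* (MvPolynomial ι k)[X]} (hX : Φ X = X)
    (hC : ∀ c : k, Φ (C (MvPolynomial.C c)) = C (MvPolynomial.C c))
    (hgen : ∀ i, X ∣ Φ (C (MvPolynomial.X i)) - C (MvPolynomial.X i)) : Function.Injective Φ := by
  refine (injective_iff_map_eq_zero Φ).mpr fun y hy => ?_
  by_contra hy0
  have hne : y.coeff y.natTrailingDegree ≠ 0 := coeff_natTrailingDegree_ne_zero.mpr hy0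
  set j := y.natTrailingDegree with hj
  obtain ⟨y', hy'⟩ : X ^ j ∣ y :=
    X_pow_dvd_iff.mpr fun d hd => coeff_eq_zero_of_lt_natTrailingDegree (hj ▸ hd)
  clear_value j
  subst hy'
  have hc : (X ^ j * y').coeff j = y'.coeff 0 := by
    rw [coeff_X_pow_mul', if_pos le_rfl, Nat.sub_self]
  obtain ⟨z, hz⟩ := X_pow_dvd_map_sub 1 hX hC (fun i => by simpa using hgen i) y'
  have hΦy : (Φ (X ^ j * y')).coeff j = y'.coeff 0 := by
    rw [map_mul, map_pow, hX, coeff_X_pow_mul', if_pos le_rfl, Nat.sub_self, (sub_eq_iff_eq_add'.mp hz), coeff_add,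
      pow_one, coeff_X_mul_zero, add_zero]
  rw [hy, coeff_zero] at hΦy
  exact hne (hc.trans hΦy.symm)

section Graded

variable {w : ι → ℚ} {ρ : ℚ}

/-- A weighted-homogeneous polynomial of NEGATIVE weight, for non-negative weights, is zero (bookkeeping). [cite: Lang2002, Ch. IV §1] -/
theorem isWeightedHomogeneous_eq_zero_of_neg (hw : ∀ i, 0 ≤ w i) {φ : MvPolynomial ι k} {m : ℚ}
    (hφ : MvPolynomial.IsWeightedHomogeneous w φ m) (hm : m < 0) : φ = 0 := by
  classical
  ext d
  rw [MvPolynomial.coeff_zero]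
  by_contra h
  have hwd : Finsupp.weight w d = m := hφ h
  have h0 : (0 : ℚ) ≤ Finsupp.weight w d := by
    rw [Finsupp.weight_apply]
    exact Finset.sum_nonneg fun i _ => nsmul_nonneg (hw i) (d i)
  exact absurd (hwd ▸ h0) (not_le.mpr hm)

/-- An element of total weight `d` divisible by `σ^n` with `n • ρ > d` is zero, for non-negative slot weights and `ρ > 0`'s worth of
`σ`-weight (bookkeeping: the `σ^s`-coefficient, `s ≥ n`, would have negative weight `d - s•ρ`). [cite: Lang2002, Ch. IV §1] -/
theorem isTW_eq_zero_of_X_pow_dvd (hw : ∀ i, 0 ≤ w i) (hρ : 0 ≤ ρ) {d : ℚ} {n : ℕ} {f : (MvPolynomial ι k)[X]}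
    (hf : IsTW w ρ d f) (hdvd : X ^ n ∣ f) (hd : d < n • ρ) : f = 0 := by
  refine Polynomial.ext fun s => ?_
  rw [coeff_zero]
  by_cases hs : s < n
  · exact X_pow_dvd_iff.mp hdvd s hs
  · refine isWeightedHomogeneous_eq_zero_of_neg hw (hf s) ?_
    have hns : n • ρ ≤ s • ρ := nsmul_le_nsmul_left hρ (not_lt.mp hs)
    linarith

/-- **A graded endomorphism `≡ id (mod σ)` is SURJECTIVE** (positive weights).  On a slot `ε_i` the operator `N = id - Φ` raises
the `σ`-order and keeps the total weight `w i`, so `N^n ε_i = 0` once `n•ρ > w i`, and the finite Neumann series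
`Σ_{k<n} N^k ε_i` is a `Φ`-preimage of `ε_i`; preimages of `σ` and of the scalars are themselves. [cite: Lang2002, Ch. IV §1, Ch. XIII §4] -/
theorem surjective {Φ : (MvPolynomial ι k)[X] →+* (MvPolynomial ι k)[X]} (hΦ : IsGradedHom w ρ Φ) (hX : Φ X = X)
    (hgen : ∀ i, X ∣ Φ (C (MvPolynomial.X i)) - C (MvPolynomial.X i)) (hw : ∀ i, 0 ≤ w i) (hρ : 0 < ρ) :
    Function.Surjective Φ := by
  -- the operator `N = id - Φ` in the ring of additive endomorphisms
  let φ : AddMonoid.End (MvPolynomial ι k)[X] := Φ.toAddMonoidHom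
  let N : AddMonoid.End (MvPolynomial ι k)[X] := 1 - φ
  have hφ : ∀ y, φ y = Φ y := fun _ => rfl
  have hsub : ∀ (f g : AddMonoid.End (MvPolynomial ι k)[X]) (y : (MvPolynomial ι k)[X]), (f - g) y = f y - g y :=
    fun _ _ _ => rfl
  have hN : ∀ y, N y = y - Φ y := fun y => rfl
  have hcong : ∀ y, X ∣ N y := fun y => by
    have h := X_pow_dvd_map_sub 1 hX hΦ.map_C_C (fun i => by simpa using hgen i) y
    rw [pow_one] at h
    rw [hN, ← neg_sub]
    exact h.neg_right
  have hNX : ∀ (j : ℕ) (y : (MvPolynomial ι k)[X]), N (X ^ j * y) = X ^ j * N y := fun j y => by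
    rw [hN, hN, map_mul, map_pow, hX, mul_sub]
  -- `σ^n ∣ N^n y`
  have hdvd : ∀ (n : ℕ) (y : (MvPolynomial ι k)[X]), X ^ n ∣ (N ^ n) y := by
    intro n
    induction n with
    | zero => intro y; simp
    | succ n ih =>
      intro y
      obtain ⟨t, ht⟩ := ih y
      obtain ⟨u, hu⟩ := hcong t
      refine ⟨u, ?_⟩
      rw [pow_succ', AddMonoid.End.coe_mul, Function.comp_apply, ht, hNX, hu, pow_succ, mul_assoc]
  -- `N^n` preserves total weight
  have hTW : ∀ (n : ℕ) {d : ℚ} {y : (MvPolynomial ι k)[X]}, IsTW w ρ d y → IsTW w ρ d ((N ^ n) y) := by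
    intro n
    induction n with
    | zero => intro d y hy; simpa using hy
    | succ n ih =>
      intro d y hy
      rw [pow_succ', AddMonoid.End.coe_mul, Function.comp_apply, hN, sub_eq_add_neg]
      exact (ih hy).add (hΦ.isTW_map (ih hy)).neg
  -- preimage of a slot generator by the finite Neumann series
  have hslot : ∀ i, ∃ x, Φ x = C (MvPolynomial.X i) := by
    intro i
    obtain ⟨n, hn⟩ := exists_lt_nsmul hρ (w i)
    have hTWi : IsTW w ρ (w i) (C (MvPolynomial.X i) : (MvPolynomial ι k)[X]) :=
      isTW_C (MvPolynomial.isWeightedHomogeneous_X k w i)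
    have hNn : (N ^ n) (C (MvPolynomial.X i)) = 0 :=
      isTW_eq_zero_of_X_pow_dvd hw hρ.le (hTW n hTWi) (hdvd n _) hn
    refine ⟨(∑ j ∈ Finset.range n, N ^ j) (C (MvPolynomial.X i)), ?_⟩
    have key : φ * ∑ j ∈ Finset.range n, N ^ j = 1 - N ^ n := by
      rw [← mul_neg_geom_sum N n]
      congr 1
      exact (sub_sub_cancel 1 φ).symm
    have := congrArg (fun T : AddMonoid.End (MvPolynomial ι k)[X] => T (C (MvPolynomial.X i))) key
    simp only [AddMonoid.End.coe_mul, Function.comp_apply, hφ] at this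
    rw [this, hsub, hNn, sub_zero]
    rfl
  -- preimages of `C a`, then of everything
  have hCa : ∀ a : MvPolynomial ι k, ∃ x, Φ x = C a := by
    intro a
    induction a using MvPolynomial.induction_on with
    | C c => exact ⟨C (MvPolynomial.C c), hΦ.map_C_C c⟩
    | add p q hp hq =>
      obtain ⟨a, ha⟩ := hp; obtain ⟨b, hb⟩ := hq
      exact ⟨a + b, by rw [map_add, ha, hb, map_add]⟩
    | mul_X p i hp =>
      obtain ⟨a, ha⟩ := hp; obtain ⟨g, hg⟩ := hslot i
      exact ⟨a * g, by rw [map_mul, ha, hg, map_mul]⟩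
  intro y
  induction y using Polynomial.induction_on' with
  | add p q hp hq =>
    obtain ⟨a, ha⟩ := hp; obtain ⟨b, hb⟩ := hq
    exact ⟨a + b, by rw [map_add, ha, hb]⟩
  | monomial n a =>
    obtain ⟨x, hx⟩ := hCa a
    exact ⟨x * X ^ n, by rw [map_mul, map_pow, hX, hx, C_mul_X_pow_eq_monomial]⟩

/-- **The automorphism.**  A graded endomorphism of `k[ε][σ]` (non-negative slot weights, `wt σ = ρ > 0`) fixing `σ` and
`≡ id (mod σ)` on the slots, as a ring equivalence `k[ε][σ] ≃+* k[ε][σ]` — so that the cell's graded isotropies live in the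
GROUP `RingAut` used by the order filtration `𝔄_m` (instrument for engine 1's `W(f)` toy model, NOT a resolution theorem).
[cite: Lang2002, Ch. IV §1, Ch. XIII §4; AbramovichTemkinWlodarczyk2024, §5.1 (p. 1575)] -/
noncomputable def toRingEquiv (Φ : (MvPolynomial ι k)[X] →+* (MvPolynomial ι k)[X]) (hΦ : IsGradedHom w ρ Φ) (hX : Φ X = X)
    (hgen : ∀ i, X ∣ Φ (C (MvPolynomial.X i)) - C (MvPolynomial.X i)) (hw : ∀ i, 0 ≤ w i) (hρ : 0 < ρ) :
    (MvPolynomial ι k)[X] ≃+* (MvPolynomial ι k)[X] :=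
  RingEquiv.ofBijective Φ ⟨injective hX hΦ.map_C_C hgen, surjective hΦ hX hgen hw hρ⟩

/-- `toRingEquiv` is `Φ` on elements (bookkeeping). [cite: Lang2002, Ch. IV §1] -/
@[simp] theorem toRingEquiv_apply {Φ : (MvPolynomial ι k)[X] →+* (MvPolynomial ι k)[X]} (hΦ : IsGradedHom w ρ Φ) (hX : Φ X = X)
    (hgen : ∀ i, X ∣ Φ (C (MvPolynomial.X i)) - C (MvPolynomial.X i)) (hw : ∀ i, 0 ≤ w i) (hρ : 0 < ρ)
    (y : (MvPolynomial ι k)[X]) : toRingEquiv Φ hΦ hX hgen hw hρ y = Φ y := rfl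

/-- The inverse fixes `σ` (bookkeeping). [cite: Lang2002, Ch. IV §1] -/
theorem toRingEquiv_symm_X {Φ : (MvPolynomial ι k)[X] →+* (MvPolynomial ι k)[X]} (hΦ : IsGradedHom w ρ Φ) (hX : Φ X = X)
    (hgen : ∀ i, X ∣ Φ (C (MvPolynomial.X i)) - C (MvPolynomial.X i)) (hw : ∀ i, 0 ≤ w i) (hρ : 0 < ρ) :
    (toRingEquiv Φ hΦ hX hgen hw hρ).symm X = X := by
  rw [RingEquiv.symm_apply_eq, toRingEquiv_apply, hX]

/-- The inverse inherits every congruence `≡ id (mod σ^m)` of `Φ` (bookkeeping: `Φ⁻¹ y - y = -(Φ z - z)` for `z = Φ⁻¹ y`).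
[cite: Lang2002, Ch. IV §1] -/
theorem X_pow_dvd_symm_apply_sub {Φ : (MvPolynomial ι k)[X] →+* (MvPolynomial ι k)[X]} (hΦ : IsGradedHom w ρ Φ)
    (hX : Φ X = X) (hgen : ∀ i, X ∣ Φ (C (MvPolynomial.X i)) - C (MvPolynomial.X i)) (hw : ∀ i, 0 ≤ w i) (hρ : 0 < ρ)
    (m : ℕ) (hgen' : ∀ i, X ^ m ∣ Φ (C (MvPolynomial.X i)) - C (MvPolynomial.X i)) (y : (MvPolynomial ι k)[X]) :
    X ^ m ∣ (toRingEquiv Φ hΦ hX hgen hw hρ).symm y - y := by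
  set z := (toRingEquiv Φ hΦ hX hgen hw hρ).symm y with hz
  have hy : Φ z = y := by
    rw [← toRingEquiv_apply hΦ hX hgen hw hρ, hz, RingEquiv.apply_symm_apply]
  rw [← hy, ← neg_sub]
  exact (X_pow_dvd_map_sub m hX hΦ.map_C_C hgen' z).neg_right

end Graded

end Literature.AlgebraicGeometry.Resolution.WeightedBlowup.UnipotentInverse
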